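import Summits.FinalStateConjecture.FinalStateConjecture.Theorems.PhotonSphereChannelsDarkFutureDefs
import Summits.FinalStateConjecture.FinalStateConjecture.Theorems.PhotonSphereChannelsChannelsResolveTameDevelopmentsROuterVacuumLimits
import Summits.FinalStateConjecture.FinalStateConjecture.Theorems.PhotonSphereChannelsChannelsResolveTameDevelopmentsRTameEndgameEmptyFibre
import Summits.FinalStateConjecture.FinalStateConjecture.Theorems.PhotonSphereChannelsChannelsResolveTameDevelopmentsRHorizonPathsExist
import Summits.FinalStateConjecture.FinalStateConjecture.Theorems.PhotonSphereChannelsChannelsResolveTameDevelopmentsRHullRebasing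
import Literature.Geometry.Lorentzian.SpacetimeLocalConvergenceSubseq
import Literature.Geometry.Lorentzian.ExteriorStabilityNullCompleteness
import HarnessLib

/-!
# Crux `ChannelsResolveTameDevelopmentsR` (K2R-T2, stmt-FinalStateConjecture-17430), line `tame-lasalle-dock`,
# stub A′ `stub_silentHull`: the TYPED REDUCTION of the producer stub to its five sub-producers

Stub A′ (`SilentHull`, VERBATIM the registered `stub_silentHull` of line `dark-future-exactness`; skeleton
`Cruxes/ChannelsResolveTameDevelopmentsR/Lines/tame_lasalle_dock.lean`) asks, for every MGHD `𝒟` of admissible data with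
`DevHyp 𝒟`, for (1) a NONEMPTY outer region and (2) ONE all-orders class `(Λ, r₀)` with (a) `OuterHullExists` (a SILENT outer
hull element along every future-escaping outer sequence), (b) `GeneratorHullExists` (a horizon-hull element along every horizon
generator path and every `sₙ → ∞`) and (c) `OuterHullShadowed`. Three waves of lead c7 found it blocked on sub-producers none of
which is a declaration. This file TYPES those sub-producers as parametrised predicates over the landed vocabulary
(`PhotonSphereChannelsDarkFutureDefs`) and proves A′'s registered text from them, consuming the landed compactness third
(`DarkFuture.exists_vacuumLimit_of_isFutureEscaping` / `exists_vacuumLimit_of_tameAllOrders`, p150201), the landed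
complete-ray glue (`DarkFuture.outerRegion_nonempty_iff_exists_completeRay`, p154149), the landed re-basing
(`subconvergesLocallyTo_rebase`, `…RHullRebasing`) and the landed horizon-existence iff (`…RHorizonPathsExist`, p152720):

* §1 the inputs. (F1) `HasCompleteRay 𝒟` — ONE future-complete normalised null ray from `Σ` (⟺ conjunct 1, landed iff;
  in print only for the Klainerman–Nicolò class: `hasCompleteRay_of_klainermanNicolo`, conditional on the named fact AND on
  the existence of a `J⁺(ι K)`-avoiding ray, which the rendering of the fact does not assert). (F0) `AllOrdersTameAt 𝒟 Λ r₀ q`,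
  `AllOrdersTameOuter` — hypothesis (ii) of the crux AT ALL ORDERS (the regularity upgrade, a crux-text debt; it refines (ii):
  `AllOrdersTameOuter.tameOuter`), and (F4a) `EventuallyTameAlongHorizon` — the same centred balls EVENTUALLY along every
  horizon generator path (horizon points are never outer, `outer ⊆ I⁻(outer)`; and (ii) is boost-blind, so no outer tame ball is
  forced to cover a given point of `closure outer`: a separate input). (F2) `TameEndOfOuterLimit` / (F4b) `TameEndOfHorizonLimit` —
  a pointed vacuum `C^∞_loc` limit along the sequence (the OUTPUT of the landed compactness third) upgrades to a limit carrying an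
  all-orders tame END (eternal far chart + clock) with base point in the closed d.o.c., resp. ON the end's horizon (lineage).
  (F3) `SilentUpgrade` — a tame-ended limit along an escaping sequence of `closure outer` upgrades to a SILENT one, keeping the
  base point's locus (the two monotone budgets; stated as an upgrade because silence of `E.far` is gauge-dependent: a tame far
  chart composed with an `x⁰`-oscillating `O(1/r)` diffeomorphism of the cylinder is tame and radiating, so "every tame end of a
  limit is silent" would be FALSE). (F5) `HorizonThreading` — the re-based sequence at a horizon point of a silent outer element
  (which EXISTS, `exists_rebase_of_isSilentHullElement`) can be threaded by one horizon generator path (lineage + threading).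
* §2 the clauses. `outerHullExists_of_upgrade` ((a) ⇐ F0 + landed limit + F2 + F3), `generatorHullExists_of_upgrade`
  ((b) ⇐ F4a + landed limit + index shift + F4b + F3), `outerHullShadowed_of_horizonThreading` ((c) ⇐ landed rebase + F5),
  the landed generator paths packaged into `IsHorizonPath` (`exists_isHorizonPath_through`, `exists_isHorizonPath_iff`), and
  the consistency of (c) with the landed horizon-existence iff: on a development WITHOUT black hole (c) says exactly that
  silent outer elements have empty horizons (`outerHullShadowed_iff_of_horizonOf_eq_empty`), and one shadowed element with a
  horizon forces `J⁺(ι X) ⊄ I⁻(outer)` (`blackHole_of_outerHullShadowed`).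
* §3 `silentHull_of_producers` — A′'s registered text VERBATIM as the conclusion.

Nothing here restates A′ or a neighbour stub as a definition; every predicate has arguments and is strictly weaker than the
clause it serves by an explicit hypothesis which the landed lemmas discharge. What remains open is recorded, with Lean
signatures, in `work/stubs/stub_silentHull.md` of the lead's folder.

References: Anderson 2004, Def. 1.1, Thm 5.1 [Anderson2004]; Petersen 2006, Ch. 10 §3.2 [Petersen2006]; Chruściel–Delay–
Galloway–Howard 2001, Thm 1.1 [ChruscielEtAl2001]; Klainerman–Nicolò 2003, Thm. 3.7.1 [KlainermanNicolo2003]; Hawking–Ellis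
1973, §9.2 [HawkingEllis1973CUP]; Wald 1984, §12.1 [Wald1984].
-/

noncomputable section

-- the operator-norm instance on `E4 →L[ℝ] E4 →L[ℝ] ℝ` needs one more level of pending
-- instance problems than the default (as in `PhotonSphereChannelsTameHullDefs.lean`)
set_option maxSynthPendingDepth 3
-- every `Summit.FinalStateConjecture.FinalStateConjecture.…` name repeats the summit = sub-problem segment (D-0017 layout)
set_option linter.dupNamespace false

open Set Filter Function TopologicalSpace Manifold Bundle
open scoped Topology Manifold ContDiff ENNReal NNReal

namespace Summit.FinalStateConjecture.FinalStateConjecture.Theorems.TameLaSalle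

open Literature.Geometry.Lorentzian
open Summit.FinalStateConjecture.FinalStateConjecture.Theorems.TameHull
open Summit.FinalStateConjecture.FinalStateConjecture.Theorems.DarkFuture
open Summit.FinalStateConjecture.FinalStateConjecture.Theorems.ChannelsResolveTameDevelopmentsR.HorizonGenerators

section Producers

variable {X : Type} [TopologicalSpace X] [ChartedSpace E3 X] [IsManifold (𝓡 3) ∞ X] [ConnectedSpace X]
  {D : InitialDataSet (𝓡 3) X}

/-! ### §1 The typed inputs F1, F0/F4a, F2/F4b, F3, F5 -/

/-- **(F1) `HasCompleteRay 𝒟` — ONE future-complete normalised null ray from the data hypersurface**: a maximal null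
geodesic `γ` from `ι p`, future-directed and normalised against the unit normal (`IsNormalisedNullRayFrom`), with affine domain
unbounded above. Equivalent to conjunct 1 `(outerRegion 𝒟).Nonempty` (`hasCompleteRay_iff_outerRegion_nonempty`); NOT asserted by
the sojourn form of complete `𝓘⁺` (`DevHyp.scri`). [cite: HawkingEllis1973CUP, §9.2 (p. 312)] -/
def HasCompleteRay (𝒟 : VacuumCauchyDevelopment D) [𝒟.metric.HasLeviCivita] : Prop :=
  ∃ (p : X) (γ : ℝ → 𝒟.carrier) (dom : Set ℝ),
    𝒟.metric.IsNormalisedNullRayFrom 𝒟.timeOrientation 𝒟.embed 𝒟.normal p γ dom ∧ ¬ BddAbove dom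

/-- **(F0, pointwise) `AllOrdersTameAt 𝒟 Λ r₀ q` — an all-orders centred tame ball at `q`**: a late chart of the Minkowski
background on `B(0, r₀)` centred at `q` with `C⁰`-deviation `≤ 1/2` and `Cᵏ`-deviation `≤ Λ k` for EVERY `k` (the per-point clause
of hypothesis (ii) `TameOuter` of the crux with the order `3` replaced by all orders — verbatim the hypothesis of the landed
`DarkFuture.exists_vacuumLimit_of_isFutureEscaping`). [cite: Anderson2004, Def. 1.1 and Thm 5.1] -/
def AllOrdersTameAt (𝒟 : VacuumCauchyDevelopment D) (Λ : ℕ → ℝ≥0) (r₀ : ℝ) (q : 𝒟.carrier) : Prop :=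
  ∃ Ψ : (⟨Metric.ball (0 : E4) r₀, Metric.isOpen_ball⟩ : Opens E4) → 𝒟.carrier,
    𝒟.toSpacetime.IsLateChart (Minkowski.backgroundOn ⟨Metric.ball (0 : E4) r₀, Metric.isOpen_ball⟩) Set.univ (-r₀) Ψ ∧
    (∃ x : (⟨Metric.ball (0 : E4) r₀, Metric.isOpen_ball⟩ : Opens E4), (x : E4) = 0 ∧ Ψ x = q) ∧
    supCkENorm (Metric.ball (0 : E4) r₀) 0
        (𝒟.toSpacetime.deviationExtend (Minkowski.backgroundOn ⟨Metric.ball (0 : E4) r₀, Metric.isOpen_ball⟩) Ψ) ≤ 1 / 2 ∧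
    ∀ k : ℕ, supCkENorm (Metric.ball (0 : E4) r₀) k
        (𝒟.toSpacetime.deviationExtend (Minkowski.backgroundOn ⟨Metric.ball (0 : E4) r₀, Metric.isOpen_ball⟩) Ψ) ≤
      ((Λ k : ℝ≥0) : ℝ≥0∞)

/-- **(F0) `AllOrdersTameOuter 𝒟 Λ r₀` — the outer region is all-orders tame**: every outer point is the centre of an
all-orders tame ball (hypothesis (ii) of the crux at all orders — Finding G of TRIAGE-r2-3, the a-priori late-time regularity
upgrade of tame vacuum exteriors: limits of `C³`-bounded vacuum metrics are not smoother). [cite: Anderson2004, Def. 1.1 and Thm 5.1] -/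
def AllOrdersTameOuter (𝒟 : VacuumCauchyDevelopment D) [𝒟.metric.HasLeviCivita] (Λ : ℕ → ℝ≥0) (r₀ : ℝ) : Prop :=
  ∀ q ∈ outerRegion 𝒟, AllOrdersTameAt 𝒟 Λ r₀ q

/-- **(F4a) `EventuallyTameAlongHorizon 𝒟 Λ r₀` — all-orders tame balls centred at LATE horizon points**: along every horizon
generator path `γ` (`IsHorizonPath`), eventually `γ s` is the centre of an all-orders tame ball. Not a consequence of (F0):
horizon points are never outer (`outer ⊆ I⁻(outer)` open, `outerRegion_subset_chronologicalPast`), and the tame balls of (ii) are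
boost-blind (`Negative/TameChartsBoostBlind`), so none of them is forced to cover a prescribed point of `closure outer`.
[cite: Anderson2004, Def. 1.1 and Thm 5.1] -/
def EventuallyTameAlongHorizon (𝒟 : VacuumCauchyDevelopment D) [𝒟.metric.HasLeviCivita] (Λ : ℕ → ℝ≥0) (r₀ : ℝ) :
    Prop :=
  ∀ γ : ℝ → 𝒟.carrier, IsHorizonPath 𝒟 γ → ∀ᶠ s in atTop, AllOrdersTameAt 𝒟 Λ r₀ (γ s)

/-- **(F2) `TameEndOfOuterLimit 𝒟 Λ r₀` — end structure of outer limits**: along every future-escaping outer sequence `q` which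
HAS a pointed vacuum `Cᵏ_loc` limit for every `k` (the output of the landed compactness third — one tame ball, no end), there is
a limit `(𝓢, p)` in `C²_loc` carrying an END `E : EndDatum 𝓢` in the all-orders class `(Λ, r₀)` (eternal far chart with
uniformly bounded constants, clock, clock-adapted centred balls — `IsTameClass`) with `p ∈ closure E.doc` (gluing of the local
limits along exhausting domains + `t`-uniform far tameness of `𝒟` + the clock). [cite: Anderson2004, Def. 1.1 and Thm 5.1] -/
def TameEndOfOuterLimit (𝒟 : VacuumCauchyDevelopment D) [𝒟.metric.HasLeviCivita] (Λ : ℕ → ℝ≥0) (r₀ : ℝ) : Prop :=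
  ∀ q : ℕ → 𝒟.carrier, IsFutureEscaping 𝒟 q →
    (∃ (𝓢 : Spacetime.{0} 4) (p : 𝓢.carrier),
      (∀ [𝓢.metric.toPseudoRiemannianMetric.HasLeviCivita], 𝓢.metric.toPseudoRiemannianMetric.IsRicciFlat) ∧
        ∀ k : ℕ, Spacetime.SubconvergesLocallyTo (fun _ ↦ 𝒟.toSpacetime) q 𝓢 p k) →
    ∃ (𝓢 : Spacetime.{0} 4) (E : EndDatum 𝓢) (p : 𝓢.carrier), IsTameClass E Λ r₀ ∧ p ∈ closure E.doc ∧
      Spacetime.SubconvergesLocallyTo (fun _ ↦ 𝒟.toSpacetime) q 𝓢 p 2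

/-- **(F4b) `TameEndOfHorizonLimit 𝒟 Λ r₀` — end structure AND LINEAGE of horizon limits**: along every horizon generator path
`γ` and `sₙ → ∞` for which `(𝒟, γ (sₙ))` has a pointed vacuum `Cᵏ_loc` limit for every `k`, there is a `C²_loc` limit carrying an
end in the class `(Λ, r₀)` whose base point lies ON the end's own future event horizon `E.horizon` (the horizon of the limit is
the limit of the horizons). [cite: Anderson2004, Def. 1.1 and Thm 5.1] -/
def TameEndOfHorizonLimit (𝒟 : VacuumCauchyDevelopment D) [𝒟.metric.HasLeviCivita] (Λ : ℕ → ℝ≥0) (r₀ : ℝ) : Prop :=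
  ∀ (γ : ℝ → 𝒟.carrier) (s : ℕ → ℝ), IsHorizonPath 𝒟 γ → Tendsto s atTop atTop →
    (∃ (𝓢 : Spacetime.{0} 4) (p : 𝓢.carrier),
      (∀ [𝓢.metric.toPseudoRiemannianMetric.HasLeviCivita], 𝓢.metric.toPseudoRiemannianMetric.IsRicciFlat) ∧
        ∀ k : ℕ, Spacetime.SubconvergesLocallyTo (fun _ ↦ 𝒟.toSpacetime) (γ ∘ s) 𝓢 p k) →
    ∃ (𝓢 : Spacetime.{0} 4) (E : EndDatum 𝓢) (p : 𝓢.carrier), IsTameClass E Λ r₀ ∧ p ∈ E.horizon ∧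
      Spacetime.SubconvergesLocallyTo (fun _ ↦ 𝒟.toSpacetime) (γ ∘ s) 𝓢 p 2

/-- **(F3) `SilentUpgrade 𝒟 Λ r₀` — silence of the limits (the two monotone budgets)**: along every sequence `x` of
`closure (outerRegion 𝒟)` which eventually leaves `J⁻(K)` for every compact `K`, a `C²_loc` limit carrying an end `E` in the
class `(Λ, r₀)` upgrades to a `C²_loc` limit carrying a SILENT end `E'` in the class (`EndDatum.IsSilent`: two-sided
non-radiating far chart, non-expanding shear-free horizon, red-shifted or cold — Bondi mass loss at `𝓘⁺` and the area theorem
made pointwise on limits), the base point staying in the closed d.o.c., resp. on the horizon, if it was. Stated as an UPGRADE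
because silence of a far chart is gauge-dependent (module docstring). [cite: ChruscielEtAl2001, Thm 1.1] -/
def SilentUpgrade (𝒟 : VacuumCauchyDevelopment D) [𝒟.metric.HasLeviCivita] (Λ : ℕ → ℝ≥0) (r₀ : ℝ) : Prop :=
  ∀ (x : ℕ → 𝒟.carrier) (𝓢 : Spacetime.{0} 4) (E : EndDatum 𝓢) (p : 𝓢.carrier),
    (∀ n, x n ∈ closure (outerRegion 𝒟)) →
    (∀ K : Set 𝒟.carrier, IsCompact K → ∀ᶠ n in atTop, x n ∉ 𝒟.metric.causalPast 𝒟.timeOrientation K) →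
    IsTameClass E Λ r₀ → Spacetime.SubconvergesLocallyTo (fun _ ↦ 𝒟.toSpacetime) x 𝓢 p 2 →
    ∃ (𝓢' : Spacetime.{0} 4) (E' : EndDatum 𝓢') (p' : 𝓢'.carrier), IsTameClass E' Λ r₀ ∧ E'.IsSilent ∧
      Spacetime.SubconvergesLocallyTo (fun _ ↦ 𝒟.toSpacetime) x 𝓢' p' 2 ∧
      (p ∈ closure E.doc → p' ∈ closure E'.doc) ∧ (p ∈ E.horizon → p' ∈ E'.horizon)

/-- **(F5) `HorizonThreading 𝒟 Λ r₀` — threading the re-based sequence by a generator**: for a silent outer hull element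
`(q, 𝓢, E, p)` and a point `p'` of the end's horizon, some sequence `x` of `𝒟` with `(𝒟, xₙ) ⇀ (𝓢, p')` always exists
(`exists_rebase_of_isSilentHullElement`, the landed re-basing); (F5) says such a sequence can be taken ON ONE HORIZON GENERATOR
PATH of `𝒟` at times `sₙ → ∞` — horizon lineage (late horizon points of `𝒟` near the frames of `q`) plus threading (one
causally monotone generator through a subsequence of them). [cite: Wald1984, §12.1] -/
def HorizonThreading (𝒟 : VacuumCauchyDevelopment D) [𝒟.metric.HasLeviCivita] (Λ : ℕ → ℝ≥0) (r₀ : ℝ) : Prop :=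
  ∀ (q : ℕ → 𝒟.carrier) (𝓢 : Spacetime.{0} 4) (E : EndDatum 𝓢) (p : 𝓢.carrier), IsSilentHullElement 𝒟 Λ r₀ q 𝓢 E p →
    ∀ p' ∈ E.horizon, (∃ x : ℕ → 𝒟.carrier, Spacetime.SubconvergesLocallyTo (fun _ ↦ 𝒟.toSpacetime) x 𝓢 p' 2) →
      ∃ (γ : ℝ → 𝒟.carrier) (s : ℕ → ℝ), IsHorizonPath 𝒟 γ ∧ Tendsto s atTop atTop ∧
        Spacetime.SubconvergesLocallyTo (fun _ ↦ 𝒟.toSpacetime) (γ ∘ s) 𝓢 p' 2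

/-! ### §1b API of the inputs: F1 ⟺ conjunct 1; F0 refines (ii); F1 for the Klainerman–Nicolò class -/

variable (𝒟 : VacuumCauchyDevelopment D) [𝒟.metric.HasLeviCivita]

/-- **(F1) is exactly conjunct 1**: a complete ray exists iff the outer region is nonempty (landed glue M0 /
`DarkFuture.outerRegion_nonempty_iff_exists_completeRay`). [cite: HawkingEllis1973CUP, §9.2 (p. 312)] -/
theorem hasCompleteRay_iff_outerRegion_nonempty : HasCompleteRay 𝒟 ↔ (outerRegion 𝒟).Nonempty :=
  (outerRegion_nonempty_iff_exists_completeRay 𝒟).symm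

variable {𝒟}

/-- **(F0) refines hypothesis (ii) of the crux**: an all-orders tame outer region is `(r₀, Λ 3)`-tame (`TameOuter`).
[cite: Anderson2004, Def. 1.1 and Thm 5.1] -/
theorem AllOrdersTameOuter.tameOuter {Λ : ℕ → ℝ≥0} {r₀ : ℝ} (h : AllOrdersTameOuter 𝒟 Λ r₀) (hr₀ : 0 < r₀) :
    TameOuter 𝒟 := by
  intro _
  refine ⟨r₀, hr₀, Λ 3, fun q hq ↦ ?_⟩
  obtain ⟨Ψ, hlate, hcentre, h0, hk⟩ := h q hq
  exact ⟨Ψ, hlate, hcentre, hk 3, h0⟩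

/-- **(F1) for admissible data in the Klainerman–Nicolò class, conditionally**: under the named fact
`klainerman_nicolo_exterior_null_completeness` (every normalised ray avoiding `J⁺(ι K)` is complete, for some compact `K`), a
maximal datum of the admissible class, strongly asymptotically flat with margin on a sole end, has a complete ray in every MGHD
PROVIDED some normalised ray from `Σ` avoids `J⁺(ι K)` for every compact `K` (the existence half of the outgoing cones
`C(λ)`, `|λ| ≥ |λ₀|`, which the rendering of the fact does not assert). [cite: KlainermanNicolo2003, Thm. 3.7.1 (ii); Cor. 1.3.5] -/
theorem hasCompleteRay_of_klainermanNicolo (hKN : klainerman_nicolo_exterior_null_completeness) {X : Type}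
    [TopologicalSpace X] [ChartedSpace E3 X] [IsManifold (𝓡 3) ∞ X] [T2Space X] [SecondCountableTopology X]
    [ConnectedSpace X] {D : InitialDataSet (𝓡 3) X} (hD : D ∈ admissibleVacuumData X) (hmax : D.IsMaximalData)
    {e : AFEnd X} {M η : ℝ} (hη : 0 < η) (he : e.IsSoleEnd)
    (hSAF : e.IsStronglyAsymptoticallyFlatWith D M (3 / 2 + η) (5 / 2 + η) 4 3) (𝒟 : VacuumCauchyDevelopment D)
    [𝒟.metric.HasLeviCivita] (h𝒟 : 𝒟.IsMaximal)
    (havoid : ∀ K : Set X, IsCompact K → ∃ (p : X) (γ : ℝ → 𝒟.carrier) (dom : Set ℝ),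
      𝒟.metric.IsNormalisedNullRayFrom 𝒟.timeOrientation 𝒟.embed 𝒟.normal p γ dom ∧
        ∀ t ∈ dom, 0 ≤ t → γ t ∉ 𝒟.metric.causalFuture 𝒟.timeOrientation (𝒟.embed '' K)) :
    HasCompleteRay 𝒟 := by
  obtain ⟨K, hK, hcomplete⟩ :=
    klainerman_nicolo_exterior_null_completeness.of_mem_admissibleVacuumData hKN hD hmax hη he hSAF 𝒟 h𝒟
  obtain ⟨p, γ, dom, hγ, hγK⟩ := havoid K hK
  exact ⟨p, γ, dom, hγ, hcomplete p γ dom hγ hγK⟩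

/-! ### §2 The three clauses of A′ from the inputs -/

/-- **(a) `OuterHullExists` ⇐ F0 + landed compactness + F2 + F3.** Along a future-escaping outer sequence `q`, the all-orders tame
outer region gives a pointed vacuum `C^∞_loc` limit (`DarkFuture.exists_vacuumLimit_of_isFutureEscaping`), F2 an end in the
class with base point in the closed d.o.c., F3 a silent one. [cite: Anderson2004, Def. 1.1 and Thm 5.1] -/
theorem outerHullExists_of_upgrade {Λ₀ : ℕ → ℝ≥0} {r₁ : ℝ} {Λ : ℕ → ℝ≥0} {r₀ : ℝ} (hr₁ : 0 < r₁)
    (h0 : AllOrdersTameOuter 𝒟 Λ₀ r₁) (h2 : TameEndOfOuterLimit 𝒟 Λ r₀) (h3 : SilentUpgrade 𝒟 Λ r₀) :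
    OuterHullExists 𝒟 Λ r₀ := by
  intro q hq
  obtain ⟨𝓢₁, E₁, p₁, hcl₁, hp₁, hconv₁⟩ := h2 q hq (exists_vacuumLimit_of_isFutureEscaping 𝒟 hr₁ Λ₀ h0 hq)
  obtain ⟨𝓢, E, p, hcl, hsil, hconv, hdoc, -⟩ :=
    h3 q 𝓢₁ E₁ p₁ (fun n ↦ subset_closure (hq.1 n)) hq.2 hcl₁ hconv₁
  exact ⟨𝓢, E, p, hq, hcl, hsil, hdoc hp₁, hconv⟩

/-- **(b) `GeneratorHullExists` ⇐ F4a + landed compactness + F4b + F3.** Along a horizon generator path `γ` and `sₙ → ∞`, the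
balls of F4a are eventually centred at `γ (sₙ)`; dropping finitely many indices, the landed compactness third
(`exists_vacuumLimit_of_tameAllOrders` on the set of tame centres) gives a pointed vacuum `C^∞_loc` limit of the shifted sequence,
hence of `γ ∘ s` (`SubconvergesLocallyTo.ofSubseq`); F4b puts an end on it with base point on the horizon, F3 makes it silent
(`γ s ∈ closure outer` and future escape are clauses of `IsHorizonPath`). [cite: Anderson2004, Def. 1.1 and Thm 5.1] -/
theorem generatorHullExists_of_upgrade {Λ₁ : ℕ → ℝ≥0} {r₂ : ℝ} {Λ : ℕ → ℝ≥0} {r₀ : ℝ} (hr₂ : 0 < r₂)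
    (h4a : EventuallyTameAlongHorizon 𝒟 Λ₁ r₂) (h4b : TameEndOfHorizonLimit 𝒟 Λ r₀) (h3 : SilentUpgrade 𝒟 Λ r₀) :
    GeneratorHullExists 𝒟 Λ r₀ := by
  intro γ hγ s hs
  -- eventually tame along `γ ∘ s`
  obtain ⟨n₀, hn₀⟩ := eventually_atTop.1 (hs.eventually (h4a γ hγ))
  -- a vacuum limit of the shifted sequence, at every order
  have hρ : StrictMono fun n : ℕ ↦ n₀ + n := fun a b hab ↦ Nat.add_lt_add_left hab n₀
  obtain ⟨𝓢₀, p₀, hvac, hconv₀⟩ := exists_vacuumLimit_of_tameAllOrders 𝒟 (S := {x | AllOrdersTameAt 𝒟 Λ₁ r₂ x})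
    hr₂ Λ₁ (fun x hx ↦ hx) (fun n ↦ γ (s (n₀ + n))) fun n ↦ hn₀ _ (Nat.le_add_right n₀ n)
  have hconv : ∀ k : ℕ, Spacetime.SubconvergesLocallyTo (fun _ ↦ 𝒟.toSpacetime) (γ ∘ s) 𝓢₀ p₀ k := fun k ↦
    Spacetime.SubconvergesLocallyTo.ofSubseq (𝓢ₙ := fun _ ↦ 𝒟.toSpacetime) (pₙ := γ ∘ s) (ρ := fun n ↦ n₀ + n)
      hρ (hconv₀ k)
  -- end + lineage, then silence
  obtain ⟨𝓢₁, E₁, p₁, hcl₁, hp₁, hconv₁⟩ := h4b γ s hγ hs ⟨𝓢₀, p₀, hvac, hconv⟩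
  obtain ⟨𝓢, E, p, hcl, hsil, hconv', -, hhor⟩ := h3 (γ ∘ s) 𝓢₁ E₁ p₁ (fun n ↦ hγ.2.2.1 (s n))
    (fun K hK ↦ hs.eventually (hγ.2.2.2.2 K hK)) hcl₁ hconv₁
  exact ⟨𝓢, E, p, hcl, hsil, hhor hp₁, hconv'⟩

/-- **What re-basing alone gives towards (c)**: every point `p'` of the limit of a silent outer hull element — in particular
every point of `E.horizon` — is the base point of a pointed `C²_loc` subconvergence from SOME sequence of `𝒟` (landed
`subconvergesLocallyTo_rebase`: the same comparison maps, re-indexed). Missing for (c): that sequence on ONE horizon generator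
path (F5). [cite: Petersen2006, Ch. 10 §3.2] -/
theorem exists_rebase_of_isSilentHullElement {Λ : ℕ → ℝ≥0} {r₀ : ℝ} {q : ℕ → 𝒟.carrier} {𝓢 : Spacetime.{0} 4}
    {E : EndDatum 𝓢} {p : 𝓢.carrier} (hZ : IsSilentHullElement 𝒟 Λ r₀ q 𝓢 E p) (p' : 𝓢.carrier) :
    ∃ x : ℕ → 𝒟.carrier, Spacetime.SubconvergesLocallyTo (fun _ ↦ 𝒟.toSpacetime) x 𝓢 p' 2 :=
  subconvergesLocallyTo_rebase hZ.2.2.2.2 p'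

/-- **Threaded re-basings are horizon-hull elements** (bookkeeping): a silent outer hull element re-based at a horizon point
`p'` along `γ ∘ s`, `sₙ → ∞`, is a horizon-hull element along `γ` with the same end. [folklore] -/
theorem isHorizonHullElement_of_thread {Λ : ℕ → ℝ≥0} {r₀ : ℝ} {q : ℕ → 𝒟.carrier} {𝓢 : Spacetime.{0} 4}
    {E : EndDatum 𝓢} {p : 𝓢.carrier} (hZ : IsSilentHullElement 𝒟 Λ r₀ q 𝓢 E p) {p' : 𝓢.carrier} (hp' : p' ∈ E.horizon)
    {γ : ℝ → 𝒟.carrier} {s : ℕ → ℝ} (hs : Tendsto s atTop atTop)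
    (hconv : Spacetime.SubconvergesLocallyTo (fun _ ↦ 𝒟.toSpacetime) (γ ∘ s) 𝓢 p' 2) :
    IsHorizonHullElement 𝒟 Λ r₀ γ 𝓢 E p' :=
  ⟨s, hs, hZ.2.1, hZ.2.2.1, hp', hconv⟩

/-- **(c) `OuterHullShadowed` ⇐ landed re-basing + F5.** Re-base the element at a point of its horizon
(`exists_rebase_of_isSilentHullElement`), thread the re-based sequence by a generator path (F5), repackage
(`isHorizonHullElement_of_thread`). [cite: Wald1984, §12.1] -/
theorem outerHullShadowed_of_horizonThreading {Λ : ℕ → ℝ≥0} {r₀ : ℝ} (h5 : HorizonThreading 𝒟 Λ r₀) :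
    OuterHullShadowed 𝒟 Λ r₀ := by
  rintro q 𝓢 E p hZ ⟨p', hp'⟩
  obtain ⟨γ, s, hγ, hs, hconv⟩ := h5 q 𝓢 E p hZ p' hp' (exists_rebase_of_isSilentHullElement hZ p')
  exact ⟨γ, p', hγ, isHorizonHullElement_of_thread hZ hp' hs hconv⟩

/-- **Horizon generator paths through every horizon point** (the landed `exists_horizonPath_through` of
`…RHorizonGeneratorPaths`, packaged into the predicate `IsHorizonPath`, which that file predates): what horizon LINEAGE alone
would give towards (c) — a generator path through each re-based horizon point, not yet one path threading a subsequence.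
[cite: HawkingEllis1973CUP, §9.2 (p. 319)] -/
theorem exists_isHorizonPath_through {h : 𝒟.carrier} (hh : h ∈ horizonOf 𝒟) :
    ∃ γ : ℝ → 𝒟.carrier, IsHorizonPath 𝒟 γ ∧ γ 0 = h := by
  obtain ⟨γ, h0, hc, h1, h2, h3, h4⟩ := exists_horizonPath_through 𝒟 hh
  exact ⟨γ, ⟨hc, h1, h2, h3, h4⟩, h0⟩

variable (𝒟) in
/-- **Horizon generator paths exist iff `horizonOf 𝒟` is nonempty** (iff the outer region is nonempty and `J⁺(ι X) ⊄ I⁻(outer)`,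
`eventHorizonOf_outerRegion_nonempty_iff`): the based hulls of (b), (c), K♭, T′ are indexed by a nonempty family exactly in the
black-hole case. [cite: HawkingEllis1973CUP, §9.2 (pp. 312, 319)] -/
theorem exists_isHorizonPath_iff : (∃ γ : ℝ → 𝒟.carrier, IsHorizonPath 𝒟 γ) ↔ (horizonOf 𝒟).Nonempty :=
  ⟨fun ⟨γ, hγ⟩ ↦ ⟨γ 0, hγ.2.1 0⟩, fun ⟨_, hh⟩ ↦
    let ⟨γ, hγ, _⟩ := exists_isHorizonPath_through hh
    ⟨γ, hγ⟩⟩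

/-- **(c) on a development without black hole.** If `horizonOf 𝒟 = ∅` (no horizon generator path exists: `γ 0 ∈ horizonOf 𝒟`),
shadowing says exactly that every silent outer hull element of the class has EMPTY horizon. [cite: HawkingEllis1973CUP, §9.2 (p. 312)] -/
theorem outerHullShadowed_iff_of_horizonOf_eq_empty {Λ : ℕ → ℝ≥0} {r₀ : ℝ} (h : horizonOf 𝒟 = ∅) :
    OuterHullShadowed 𝒟 Λ r₀ ↔ ∀ (q : ℕ → 𝒟.carrier) (𝓢 : Spacetime.{0} 4) (E : EndDatum 𝓢) (p : 𝓢.carrier),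
      IsSilentHullElement 𝒟 Λ r₀ q 𝓢 E p → E.horizon = ∅ := by
  refine ⟨fun H q 𝓢 E p hZ ↦ ?_, fun H q 𝓢 E p hZ hne ↦ absurd (H q 𝓢 E p hZ) hne.ne_empty⟩
  by_contra hne
  obtain ⟨γ, -, hγ, -⟩ := H q 𝓢 E p hZ (nonempty_iff_ne_empty.2 hne)
  simpa [h] using hγ.2.1 0

/-- **A shadowed element with a horizon forces a horizon of the development**: its generator path has `γ 0 ∈ horizonOf 𝒟`.
[cite: Wald1984, §12.1] -/
theorem horizonOf_nonempty_of_outerHullShadowed {Λ : ℕ → ℝ≥0} {r₀ : ℝ} (H : OuterHullShadowed 𝒟 Λ r₀)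
    {q : ℕ → 𝒟.carrier} {𝓢 : Spacetime.{0} 4} {E : EndDatum 𝓢} {p : 𝓢.carrier}
    (hZ : IsSilentHullElement 𝒟 Λ r₀ q 𝓢 E p) (hE : E.horizon.Nonempty) : (horizonOf 𝒟).Nonempty := by
  obtain ⟨γ, -, hγ, -⟩ := H q 𝓢 E p hZ hE
  exact ⟨γ 0, hγ.2.1 0⟩

/-- **… hence a black hole to the future of the data**: `J⁺(ι X) ⊄ I⁻(outer)` (landed
`eventHorizonOf_outerRegion_nonempty_iff` of `…RHorizonPathsExist`: the horizon of the development is nonempty iff the outer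
region is nonempty and the black-hole region meets `J⁺(ι X)`). [cite: HawkingEllis1973CUP, §9.2 (p. 312)] -/
theorem blackHole_of_outerHullShadowed {Λ : ℕ → ℝ≥0} {r₀ : ℝ} (H : OuterHullShadowed 𝒟 Λ r₀)
    {q : ℕ → 𝒟.carrier} {𝓢 : Spacetime.{0} 4} {E : EndDatum 𝓢} {p : 𝓢.carrier}
    (hZ : IsSilentHullElement 𝒟 Λ r₀ q 𝓢 E p) (hE : E.horizon.Nonempty) :
    (𝒟.metric.causalFuture 𝒟.timeOrientation (range 𝒟.embed) \
      𝒟.metric.chronologicalPast 𝒟.timeOrientation (outerRegion 𝒟)).Nonempty :=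
  ((eventHorizonOf_outerRegion_nonempty_iff 𝒟).1 (horizonOf_nonempty_of_outerHullShadowed H hZ hE)).2

/-- **A′ for ONE development from the inputs** (no admissibility or `DevHyp` is consumed by the logic: they are handed to the
producers). [cite: Anderson2004, Def. 1.1 and Thm 5.1] -/
theorem silentHull_of_producers_one (hray : HasCompleteRay 𝒟) {Λ₀ : ℕ → ℝ≥0} {r₁ : ℝ} (hr₁ : 0 < r₁)
    (h0 : AllOrdersTameOuter 𝒟 Λ₀ r₁) {Λ₁ : ℕ → ℝ≥0} {r₂ : ℝ} (hr₂ : 0 < r₂) (h4a : EventuallyTameAlongHorizon 𝒟 Λ₁ r₂)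
    {Λ : ℕ → ℝ≥0} {r₀ : ℝ} (hr₀ : 0 < r₀) (h2 : TameEndOfOuterLimit 𝒟 Λ r₀) (h4b : TameEndOfHorizonLimit 𝒟 Λ r₀)
    (h3 : SilentUpgrade 𝒟 Λ r₀) (h5 : HorizonThreading 𝒟 Λ r₀) :
    (outerRegion 𝒟).Nonempty ∧
      ∃ (Λ : ℕ → ℝ≥0) (r₀ : ℝ), 0 < r₀ ∧ OuterHullExists 𝒟 Λ r₀ ∧ GeneratorHullExists 𝒟 Λ r₀ ∧
        OuterHullShadowed 𝒟 Λ r₀ :=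
  ⟨(hasCompleteRay_iff_outerRegion_nonempty 𝒟).1 hray, Λ, r₀, hr₀, outerHullExists_of_upgrade hr₁ h0 h2 h3,
    generatorHullExists_of_upgrade hr₂ h4a h4b h3, outerHullShadowed_of_horizonThreading h5⟩

end Producers

/-! ### §3 A′'s registered text from the producers -/

/-- **Reduction of stub A′ `stub_silentHull` to its typed sub-producers** (A′'s registered text VERBATIM as the conclusion).
If every MGHD `𝒟` of admissible data with `DevHyp 𝒟` has (F1) a complete normalised null ray from `Σ`, (F0) an all-orders tame
outer region and (F4a) all-orders tame balls eventually along every horizon generator path, and, in ONE class `(Λ, r₀)`, `0 < r₀`,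
(F2) ends on its outer vacuum limits, (F4b) ends with lineage on its horizon vacuum limits, (F3) the silent upgrade and (F5)
horizon threading, then `SilentHull` holds: conjunct 1 by the landed glue M0, (a) by the landed compactness third + F2 + F3,
(b) by the landed compactness third + F4b + F3, (c) by the landed re-basing + F5. [cite: Anderson2004, Def. 1.1 and Thm 5.1] -/
theorem silentHull_of_producers : (∀ {X : Type} [TopologicalSpace X] [ChartedSpace E3 X] [IsManifold (𝓡 3) ∞ X] [T2Space X] [SecondCountableTopology X] [ConnectedSpace X] {D : InitialDataSet (𝓡 3) X}, D ∈ admissibleVacuumData X → ∀ (𝒟 : VacuumCauchyDevelopment D) [𝒟.metric.HasLeviCivita], DevHyp 𝒟 → HasCompleteRay 𝒟) → (∀ {X : Type} [TopologicalSpace X] [ChartedSpace E3 X] [IsManifold (𝓡 3) ∞ X] [T2Space X] [SecondCountableTopology X] [ConnectedSpace X] {D : InitialDataSet (𝓡 3) X}, D ∈ admissibleVacuumData X → ∀ (𝒟 : VacuumCauchyDevelopment D) [𝒟.metric.HasLeviCivita], DevHyp 𝒟 → (∃ (Λ₀ : ℕ → ℝ≥0) (r₁ : ℝ), 0 < r₁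 ∧ AllOrdersTameOuter 𝒟 Λ₀ r₁) ∧ ∃ (Λ₁ : ℕ → ℝ≥0) (r₂ : ℝ), 0 < r₂ ∧ EventuallyTameAlongHorizon 𝒟 Λ₁ r₂) → (∀ {X : Type} [TopologicalSpace X] [ChartedSpace E3 X] [IsManifold (𝓡 3) ∞ X] [T2Space X] [SecondCountableTopology X] [ConnectedSpace X] {D : InitialDataSet (𝓡 3) X}, D ∈ admissibleVacuumData X → ∀ (𝒟 : VacuumCauchyDevelopment D) [𝒟.metric.HasLeviCivita], DevHyp 𝒟 → ∃ (Λ : ℕ → ℝ≥0) (r₀ : ℝ), 0 < r₀ ∧ TameEndOfOuterLimit 𝒟 Λ r₀ ∧ TameEndOfHorizonLimit 𝒟 Λ r₀ ∧ SilentUpgrade 𝒟 Λ r₀ ∧ HorizonThreading 𝒟 Λ r₀) → ∀ (X : Type) [TopologicalSpace X] [ChartedSpace E3 X] [IsManifold (𝓡 3) ∞ X] [T2Space X] [SecondCountableTopology X] [ConnectedSpace X], ∀ D ∈ admissibleVacuumData X, ∀ (𝒟 : VacuumCauchyDevelopment D) [𝒟.metric.HasLeviCivita], DevHyp 𝒟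 → (outerRegion 𝒟).Nonempty ∧ ∃ (Λ : ℕ → ℝ≥0) (r₀ : ℝ), 0 < r₀ ∧ OuterHullExists 𝒟 Λ r₀ ∧ GeneratorHullExists 𝒟 Λ r₀ ∧ OuterHullShadowed 𝒟 Λ r₀ := by
  intro hF1 hF0 hF X _ _ _ _ _ _ D hD 𝒟 _ hdev
  obtain ⟨⟨Λ₀, r₁, hr₁, h0⟩, Λ₁, r₂, hr₂, h4a⟩ := hF0 hD 𝒟 hdev
  obtain ⟨Λ, r₀, hr₀, h2, h4b, h3, h5⟩ := hF hD 𝒟 hdev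
  exact silentHull_of_producers_one (hF1 hD 𝒟 hdev) hr₁ h0 hr₂ h4a hr₀ h2 h4b h3 h5

end Summit.FinalStateConjecture.FinalStateConjecture.Theorems.TameLaSalle

end
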